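import Summits.Langlands.Langlands.Theses.BrauerHeilbronnDescent

/-!
# Birth skeleton (BC3) of the crux `RigidityOfWeakAssociation` (stmt-Langlands-19254)

Route `BrauerHeilbronnDescent` (crux rank 5): given direction (A) over `F` in all ranks (w.r.t.
reciprocity data `R`), an automorphic representation `P` of `GL_n(𝔸_F)` (Borel–Jacquet datum: an
irreducible subquotient `W / W'` of the space of automorphic forms) weakly associated with an
irreducible `R`-geometric `ρ : Γ_F → GL_n(ℚ̄_ℓ)` (a.e. Satake = Frobenius) can be replaced by an
L-algebraic CUSPIDAL `π` of any prescribed level structure, weakly associated with `ρ`.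

## The line: cuspidal support ⟶ archimedean algebraicity of the blocks ⟶ one block

The crux is cut at its three mathematical joints, each a named stub:

* `stub_cuspidalSupport` — LANGLANDS' LEMMA (known in print; size L in Lean): every automorphic
  `P` of `GL_n(𝔸_F)` is a constituent of a representation induced from cuspidal data
  `π₁ ⊗ ⋯ ⊗ π_k` on `GL_{m₁} × ⋯ × GL_{m_k}`, `∑ m_j = n`, and at almost every finite place every
  Satake parameter of `P` is the multiset sum of Satake parameters of the blocks (the unramified
  constituent of an unramified principal series is unique; transitivity of normalised induction).
  Langlands 1979 (Corvallis, "On the notion of an automorphic representation", Prop. 2);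
  Borel–Jacquet 1979, 4.6; Jacquet–Shalika 1981 II, §4. Independent of `ρ`: pure automorphic
  input, so it cannot imply the crux or the summit.
* `stub_blocksLAlgebraic` — ARCHIMEDEAN ALGEBRAICITY (the planner's flagged risk, isolated):
  if cuspidal blocks `π_j` have Satake sums matching the Frobenius characteristic polynomials of an
  irreducible geometric `ρ` almost everywhere (given (A) over `F`), then EVERY block is L-algebraic
  (integral Harish-Chandra parameter). For `k = 1` this is "a cuspidal `π` weakly associated with a
  geometric `ρ` is L-algebraic" (expected: de Rham ⇒ Hodge–Tate weights ⇒ integral infinitesimal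
  character; known for `n = 1` via locally algebraic characters, Serre/Waldschmidt; in general it
  is implied by the summit through strong multiplicity one). Why it might fail: weak association
  sees only finite places; L-algebraicity of `π_∞` needs purity/temperedness or a `p`-adic
  Hodge-theoretic handle on the Hecke eigensystem (Buzzard–Gee 2014 §3.1, Conj. 3.1.5/3.1.6;
  Clozel 1990 §1, §3).
* `stub_oneBlock` — GALOIS-SIDE RIGIDITY (size L, provable in principle from tree inputs): given
  (A) over `F` in all ranks, L-ALGEBRAIC cuspidal blocks `π_j` (`m_j > 0`, `∑ m_j = n`) whose
  Satake sums match an IRREDUCIBLE geometric `ρ` a.e. form exactly ONE block (`k = 1`): (A) attaches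
  `ρ_j = ρ_{π_j,ι}` to each block, uniqueness of Satake parameters identifies the block parameters,
  `charpoly ρ(Frob_v) = ∏_j charpoly ρ_j(Frob_v)` a.e., Chebotarev + Brauer–Nesbitt give
  `ρ^ss ≅ ⊕_j ρ_j`, and irreducibility of `ρ` forces `k = 1` (tree: `PatchingLemma.exists_conj_of_trace_eq`,
  named fact `AutomorphicRepData.hasSatakeParamAt_unique`).

The composition `RigidityOfWeakAssociation_of` is a real proof: it merges the weak association
of `P` with the block decomposition (`Filter.Eventually.and/mono`), gets L-algebraicity of the
blocks, collapses to one block, and transports the single block `π 0 : GL_{m 0}` to `GL_n` along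
`m 0 = n` (`cuspidal_transport`, by `subst` + proof irrelevance of the level witnesses).
Sorries: exactly three, one per `stub_*`.

Shape (for `ledger skeleton check`): stubs `theorem stub_<name> : <signature> := by sorry` over tree
declarations only; `_Goal.stub_<name> : Prop := type_of% @stub_<name>` names each statement; the
composition `RigidityOfWeakAssociation_of (hSupp : _Goal.stub_cuspidalSupport)
(hAlg : _Goal.stub_blocksLAlgebraic) (hOne : _Goal.stub_oneBlock) : RigidityOfWeakAssociation` is proved
without `sorry`.
-/

set_option linter.dupNamespace false
set_option linter.unusedVariables false

-- `open scoped Classical` is needed to see Mathlib's instances on `mixedSpace F` (note H5 of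
-- `AdelicGLnGlue`), through which `AutomorphyDatum.gl n F hcpt'` is typed.
open scoped Classical

namespace Summit.Langlands.Langlands.Cruxes.RigidityOfWeakAssociation.Birth

/-! ## Registered stubs -/

/-- STUB 1 — CUSPIDAL SUPPORT WITH SATAKE UNION (Langlands' lemma; known in print, size L in
Lean): every automorphic representation `P` of `GL_n(𝔸_F)` (`n ≥ 1`) admits cuspidal blocks
`π_j` on `GL_{m_j}(𝔸_F)`, `m_j > 0`, `∑_j m_j = n`, such that at all but finitely many finite
places `v` EVERY Satake parameter of `P` at `v` is the multiset sum of Satake parameters of the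
blocks at `v` (`P` is a constituent of `Ind(π₁ ⊗ ⋯ ⊗ π_k)`; the unramified constituent of an
unramified principal series is unique, normalised induction is transitive). Stated with
`∀ β, P.HasSatakeParamAt v β → …` so that no uniqueness-of-Satake-parameter fact is consumed by
the composition. Why it might fail as typed: only through a mismatch between the tree's adelic
`HasSatakeParamAt` (Hecke eigenform modulo `W'` at a level prime to `v`) for the subquotient `P`
and for the blocks — the printed statement is a theorem.
[cite: Langlands1979Notion, Prop. 2] [cite: BorelJacquet1979, 4.6]
[cite: JacquetShalikaAJM1981II, Thm. 4.4] -/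
theorem stub_cuspidalSupport :
    ∀ (F : Type) [Field F] [NumberField F] (n : ℕ), 0 < n →
      ∀ (hcpt' : Literature.NumberTheory.Automorphic.isCompact_glFiniteIntegralLevel n F)
        (P : Literature.NumberTheory.Automorphic.AutomorphicRepData
          (Literature.NumberTheory.Automorphic.AutomorphyDatum.gl n F hcpt')),
        ∃ (k : ℕ) (m : Fin k → ℕ)
          (hc : ∀ j, Literature.NumberTheory.Automorphic.isCompact_glFiniteIntegralLevel (m j) F)
          (π : ∀ j, Literature.NumberTheory.Automorphic.CuspidalAutomorphicRepData (m j) F (hc j)),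
          (∀ j, 0 < m j) ∧ (∑ j, m j = n) ∧
            ∀ᶠ v : IsDedekindDomain.HeightOneSpectrum (NumberField.RingOfIntegers F) in Filter.cofinite,
              ∀ β : Multiset ℂ, P.HasSatakeParamAt v β →
                ∃ α : Fin k → Multiset ℂ, (∀ j, (π j).1.HasSatakeParamAt v (α j)) ∧ β = ∑ j, α j := by
  sorry

/-- STUB 2 — THE BLOCKS ARE L-ALGEBRAIC (archimedean algebraicity from geometricity; the named
risk of the crux): given direction (A) over `F` in all ranks, if cuspidal blocks `π_j` on
`GL_{m_j}(𝔸_F)` (`m_j > 0`) have, at almost every finite place, Satake parameters whose sum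
predicts the characteristic polynomial of arithmetic Frobenius of an irreducible `R`-geometric
`ρ : Γ_F → GL_n(ℚ̄_ℓ)` (`arithFrobPolyOfSatake`, no half-twist), then every block is L-algebraic.
For one block this is "cuspidal + weakly associated with geometric ⇒ L-algebraic" (de Rham at
`ℓ` ⇒ integral Hodge–Tate weights ⇒ integral infinitesimal character of `π_∞`; `n = 1`: locally
algebraic characters); implied by the summit via strong multiplicity one. Why it might fail: weak
association constrains only the finite places; L-algebraicity of `π_∞` needs purity /
temperedness or a `p`-adic handle on the Hecke eigensystem not in the tree, and for `k ≥ 2` the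
statement is expected to be vacuous only because of STUB 3.
[cite: BuzzardGeeLMS2014, Def. 3.1.1, Conj. 3.1.5–3.1.6, Conj. 3.2.2] [cite: Clozel1990, §1.2, §3.3–3.5]
[cite: CijsouwWaldschmidt1977] -/
theorem stub_blocksLAlgebraic :
    ∀ (F : Type) [Field F] [NumberField F] (n : ℕ), 0 < n →
      ∀ (ℓ : ℕ) [Fact ℓ.Prime] (ι : PadicAlgCl ℓ ≃+* ℂ) (R : ReciprocityData F)
        (ρ : Literature.NumberTheory.GaloisRepresentations.FramedGaloisRep F (PadicAlgCl ℓ) n),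
        ρ.toGaloisRep.IsIrreducible → IsGeometricFramed R ρ →
        (∀ m : ℕ, 0 < m →
          ∀ hc : Literature.NumberTheory.Automorphic.isCompact_glFiniteIntegralLevel m F,
            AutomorphicToGalois m R hc) →
        ∀ (k : ℕ) (m : Fin k → ℕ)
          (hc : ∀ j, Literature.NumberTheory.Automorphic.isCompact_glFiniteIntegralLevel (m j) F)
          (π : ∀ j, Literature.NumberTheory.Automorphic.CuspidalAutomorphicRepData (m j) F (hc j)),
          (∀ j, 0 < m j) →
          (∀ᶠ v : IsDedekindDomain.HeightOneSpectrum (NumberField.RingOfIntegers F) in Filter.cofinite,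
              ∃ α : Fin k → Multiset ℂ, (∀ j, (π j).1.HasSatakeParamAt v (α j)) ∧
                ρ.IsUnramifiedAt v ∧
                ρ.HasFrobCharpolyAt v
                  (Literature.NumberTheory.Automorphic.arithFrobPolyOfSatake ι v.residueCard 1
                    (∑ j, α j))) →
          ∀ j, (π j).1.IsLAlgebraic := by
  sorry

/-- STUB 3 — ONE BLOCK (Galois-side rigidity; size L): given direction (A) over `F` in all ranks,
L-algebraic cuspidal blocks `π_j` on `GL_{m_j}(𝔸_F)` (`m_j > 0`, `∑_j m_j = n`) whose Satake sums
predict the Frobenius characteristic polynomials of an IRREDUCIBLE `R`-geometric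
`ρ : Γ_F → GL_n(ℚ̄_ℓ)` at almost every place form exactly one block: `k = 1`. Mechanism: (A) gives
`ρ_j = ρ_{π_j,ι}` with `Corresponds`, uniqueness of Satake parameters (named fact
`AutomorphicRepData.hasSatakeParamAt_unique`) identifies the block parameters with those of
`ρ_j`, so `charpoly ρ(Frob_v) = ∏_j charpoly ρ_j(Frob_v)` a.e.
(`arithFrobPolyOfSatake` is multiplicative in the multiset); Chebotarev density + Brauer–Nesbitt
(tree: `PatchingLemma.exists_conj_of_trace_eq`) give `ρ^ss ≅ ⊕_j ρ_j`, and irreducibility of `ρ`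
forces `k = 1` (`k = 0` is excluded by `0 < n = ∑ m_j`). Why it might fail as typed: only in the
plumbing — block-diagonal framed sums over `Fin`-indexed ranks and Chebotarev for `ℓ`-adic
representations are not yet assembled in the tree; the mathematics is standard.
[cite: DeligneSerre1974, Lemme 8.4 ff.] [cite: BuzzardGeeLMS2014, §3.2]
[cite: JacquetShalikaAJM1981II, Thm. 4.4] -/
theorem stub_oneBlock :
    ∀ (F : Type) [Field F] [NumberField F] (n : ℕ), 0 < n →
      ∀ (ℓ : ℕ) [Fact ℓ.Prime] (ι : PadicAlgCl ℓ ≃+* ℂ) (R : ReciprocityData F)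
        (ρ : Literature.NumberTheory.GaloisRepresentations.FramedGaloisRep F (PadicAlgCl ℓ) n),
        ρ.toGaloisRep.IsIrreducible → IsGeometricFramed R ρ →
        (∀ m : ℕ, 0 < m →
          ∀ hc : Literature.NumberTheory.Automorphic.isCompact_glFiniteIntegralLevel m F,
            AutomorphicToGalois m R hc) →
        ∀ (k : ℕ) (m : Fin k → ℕ)
          (hc : ∀ j, Literature.NumberTheory.Automorphic.isCompact_glFiniteIntegralLevel (m j) F)
          (π : ∀ j, Literature.NumberTheory.Automorphic.CuspidalAutomorphicRepData (m j) F (hc j)),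
          (∀ j, 0 < m j) → (∑ j, m j = n) → (∀ j, (π j).1.IsLAlgebraic) →
          (∀ᶠ v : IsDedekindDomain.HeightOneSpectrum (NumberField.RingOfIntegers F) in Filter.cofinite,
              ∃ α : Fin k → Multiset ℂ, (∀ j, (π j).1.HasSatakeParamAt v (α j)) ∧
                ρ.IsUnramifiedAt v ∧
                ρ.HasFrobCharpolyAt v
                  (Literature.NumberTheory.Automorphic.arithFrobPolyOfSatake ι v.residueCard 1
                    (∑ j, α j))) →
          k = 1 := by
  sorry

/-! ## Plumbing (proved): transport of a cuspidal block along an equality of ranks -/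

/-- Transport of a weakly associated L-algebraic cuspidal `π₀` on `GL_{n₀}` to `GL_n` along
`n₀ = n` (the level witnesses are proofs of one proposition, identified by proof irrelevance).
[folklore] -/
theorem cuspidal_transport {F : Type} [Field F] [NumberField F] {ℓ : ℕ} [Fact ℓ.Prime]
    (ι : PadicAlgCl ℓ ≃+* ℂ) {n n₀ : ℕ} (h : n₀ = n)
    (ρ : Literature.NumberTheory.GaloisRepresentations.FramedGaloisRep F (PadicAlgCl ℓ) n)
    {hc₀ : Literature.NumberTheory.Automorphic.isCompact_glFiniteIntegralLevel n₀ F}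
    (π₀ : Literature.NumberTheory.Automorphic.CuspidalAutomorphicRepData n₀ F hc₀)
    (hcpt : Literature.NumberTheory.Automorphic.isCompact_glFiniteIntegralLevel n F)
    (halg : π₀.1.IsLAlgebraic)
    (hm : ∀ᶠ v : IsDedekindDomain.HeightOneSpectrum (NumberField.RingOfIntegers F) in Filter.cofinite,
      ∃ α : Multiset ℂ, π₀.1.HasSatakeParamAt v α ∧ ρ.IsUnramifiedAt v ∧
        ρ.HasFrobCharpolyAt v
          (Literature.NumberTheory.Automorphic.arithFrobPolyOfSatake ι v.residueCard 1 α)) :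
    ∃ π : Literature.NumberTheory.Automorphic.CuspidalAutomorphicRepData n F hcpt,
      π.1.IsLAlgebraic ∧
        ∀ᶠ v : IsDedekindDomain.HeightOneSpectrum (NumberField.RingOfIntegers F) in Filter.cofinite,
          SatakeFrobCompatibleAt ι π.1 ρ v := by
  subst h
  exact ⟨π₀, halg, hm⟩

/-! ## The stub statements as named `Prop`s (literally their types) -/

namespace _Goal

/-- The statement of `stub_cuspidalSupport`, as a named `Prop` (literally its type). [folklore] -/
def stub_cuspidalSupport : Prop :=
  type_of% @Summit.Langlands.Langlands.Cruxes.RigidityOfWeakAssociation.Birth.stub_cuspidalSupport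

/-- The statement of `stub_blocksLAlgebraic`, as a named `Prop` (literally its type). [folklore] -/
def stub_blocksLAlgebraic : Prop :=
  type_of% @Summit.Langlands.Langlands.Cruxes.RigidityOfWeakAssociation.Birth.stub_blocksLAlgebraic

/-- The statement of `stub_oneBlock`, as a named `Prop` (literally its type). [folklore] -/
def stub_oneBlock : Prop :=
  type_of% @Summit.Langlands.Langlands.Cruxes.RigidityOfWeakAssociation.Birth.stub_oneBlock

end _Goal

/-! ## The composition (kernel-checked, no `sorry`) -/

/-- COMPOSITION: the three stub statements — by name, `_Goal.stub_*` — imply the crux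
`BrauerHeilbronnDescent.RigidityOfWeakAssociation` (route decl, by name). Cuspidal support of `P`
(stub 1) merged with the weak association of `P` and `ρ` gives blocks whose Satake sums match `ρ`
a.e.; the blocks are L-algebraic (stub 2); an irreducible `ρ` admits one block (stub 3); the
block `π 0` on `GL_{m 0}`, `m 0 = n`, is transported to the prescribed level on `GL_n`
(`cuspidal_transport`). [folklore] -/
theorem RigidityOfWeakAssociation_of (hSupp : _Goal.stub_cuspidalSupport)
    (hAlg : _Goal.stub_blocksLAlgebraic) (hOne : _Goal.stub_oneBlock) :
    Summit.Langlands.Langlands.Theses.BrauerHeilbronnDescent.RigidityOfWeakAssociation := by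
  -- the stub statements, as the Π-types they literally are
  have hSupp' : type_of% @stub_cuspidalSupport := hSupp
  have hAlg' : type_of% @stub_blocksLAlgebraic := hAlg
  have hOne' : type_of% @stub_oneBlock := hOne
  intro F _ _ n hn ℓ _ ι R ρ hirr hgeo hA hcpt' P hweak hcpt
  -- (1) cuspidal support of `P` with Satake union
  obtain ⟨k, m, hc, π, hpos, hsum, hP⟩ := hSupp' F n hn hcpt' P
  -- (2) merge with the weak association `P ~ ρ`: the block sums predict Frobenius of `ρ` a.e.
  have hmatch : ∀ᶠ v : IsDedekindDomain.HeightOneSpectrum (NumberField.RingOfIntegers F) in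
      Filter.cofinite, ∃ α : Fin k → Multiset ℂ, (∀ j, (π j).1.HasSatakeParamAt v (α j)) ∧
        ρ.IsUnramifiedAt v ∧
        ρ.HasFrobCharpolyAt v
          (Literature.NumberTheory.Automorphic.arithFrobPolyOfSatake ι v.residueCard 1 (∑ j, α j)) :=
    (hweak.and hP).mono fun v hv => by
      obtain ⟨⟨β, hβ, hur, hchar⟩, hv⟩ := hv
      obtain ⟨α, hα, rfl⟩ := hv β hβ
      exact ⟨α, hα, hur, hchar⟩
  -- (3) the blocks are L-algebraic
  have halg : ∀ j, (π j).1.IsLAlgebraic := hAlg' F n hn ℓ ι R ρ hirr hgeo hA k m hc π hpos hmatch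
  -- (4) an irreducible `ρ` has exactly one block
  have hk : k = 1 := hOne' F n hn ℓ ι R ρ hirr hgeo hA k m hc π hpos hsum halg hmatch
  subst hk
  -- (5) the single block `π 0` on `GL_{m 0}`, `m 0 = n`, transported to level `hcpt` on `GL_n`
  have hm0 : m 0 = n := by simpa using hsum
  have hmatch0 : ∀ᶠ v : IsDedekindDomain.HeightOneSpectrum (NumberField.RingOfIntegers F) in
      Filter.cofinite, ∃ α : Multiset ℂ, (π 0).1.HasSatakeParamAt v α ∧ ρ.IsUnramifiedAt v ∧
        ρ.HasFrobCharpolyAt v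
          (Literature.NumberTheory.Automorphic.arithFrobPolyOfSatake ι v.residueCard 1 α) :=
    hmatch.mono fun v hv => by
      obtain ⟨α, hα, hur, hchar⟩ := hv
      exact ⟨α 0, hα 0, hur, by simpa using hchar⟩
  exact cuspidal_transport ι hm0 ρ (π 0) hcpt (halg 0) hmatch0

/-- By-name sanity check (an `example`, not a declaration of the file): the three registered stubs
feed the composition as they stand (inherits their `sorry`s, contains none). -/
example : Summit.Langlands.Langlands.Theses.BrauerHeilbronnDescent.RigidityOfWeakAssociation :=
  RigidityOfWeakAssociation_of stub_cuspidalSupport stub_blocksLAlgebraic stub_oneBlock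

end Summit.Langlands.Langlands.Cruxes.RigidityOfWeakAssociation.Birth
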